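import Literature.Topology.FourManifolds.EmbeddingGerms
import Literature.Topology.FourManifolds.CircleDiffeotopyProofs
import Literature.Topology.FourManifolds.CircleUntwist
import Mathlib.Analysis.InnerProductSpace.Calculus
import Mathlib.Analysis.Calculus.LocalExtr.Basic
import HarnessLib

/-!
# The boundary diffeomorphism of an embedding germ of the closed disc onto itself
# (first step of: `Diff⁺(D²)` is connected, in ambient-germ form)

Topic `Literature/Topology/FourManifolds` (programme of the fact
`Literature.Topology.FourManifolds.cerf_pi0DiffDisc_relBoundary_three`, brick C3a: realising reparametrisations of the faces of
Cerf's model pieces).  Let `d : ℝ² → ℝ²` be an embedding germ along the closed unit disc `𝔻²`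
with `d '' 𝔻² = 𝔻²` (`EmbeddingGerms.IsEmbGerm`).  Then `d` maps the open disc onto itself and
the unit circle onto itself (`image_ball_eq`, `image_sphere_eq`: the image of the open disc is
open, hence interior; the same for an inverse germ), and its restriction to the circle is a
diffeomorphism of `𝕊¹` (`exists_circleDiffeomorph`), the input of Hirsch's Thm. 8.3.3
(`CircleDiffeotopyProofs`) in the proof that `d` is isotopic to the identity through such germs.

## References
* [HirschDT1976] M. W. Hirsch, *Differential Topology*, GTM 33 (1976), Ch. 8 §3, Thm. 3.3.
* [CerfDiffeoSphere1968] J. Cerf, LNM 53 (1968), Ch. IV §3, Propriété 3 (diffeomorphisms of the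
  models and of their faces).
-/

noncomputable section

open Set Function Filter Topology Metric
open scoped ContDiff Manifold RealInnerProductSpace

namespace Literature.Topology.FourManifolds

/-- Local notation: `𝔼 n` is the model Euclidean space `EuclideanSpace ℝ (Fin n)`. -/
local notation "𝔼 " n:arg => EuclideanSpace ℝ (Fin n)
/-- Local notation: `𝕊 n` is the unit sphere in `EuclideanSpace ℝ (Fin (n + 1))`. -/
local notation "𝕊 " n:arg => (Metric.sphere (0 : EuclideanSpace ℝ (Fin (n + 1))) 1)
/-- Local notation: `𝔻 n` is the closed unit ball in `EuclideanSpace ℝ (Fin n)`. -/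
local notation "𝔻 " n:arg => (Metric.closedBall (0 : EuclideanSpace ℝ (Fin n)) 1)

attribute [local instance] fact_finrank_euclideanSpace_succ

namespace IsEmbGerm

variable {n : ℕ} {d : 𝔼 (n + 1) → 𝔼 (n + 1)}

/-- An embedding germ of the closed unit ball onto itself maps the open unit ball into itself
(the image of the open ball is open and contained in the closed ball). [folklore] -/
theorem image_ball_subset (hd : IsEmbGerm (𝔻 (n + 1)) d) (himg : d '' (𝔻 (n + 1)) = 𝔻 (n + 1)) :
    d '' ball (0 : 𝔼 (n + 1)) 1 ⊆ ball 0 1 := by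
  haveI : CompleteSpace (𝔼 (n + 1)) := FiniteDimensional.complete ℝ _
  obtain ⟨U, hUo, hKU, -, hinv⟩ := hd.exists_nhds (isCompact_closedBall 0 1)
  have hopen : IsOpen (d '' ball (0 : 𝔼 (n + 1)) 1) :=
    isOpen_image hd.contDiff isOpen_ball fun x hx => hinv x (hKU (ball_subset_closedBall hx))
  have hsub : d '' ball (0 : 𝔼 (n + 1)) 1 ⊆ 𝔻 (n + 1) := by
    rw [← himg]; exact image_mono ball_subset_closedBall
  have h := interior_maximal hsub hopen
  rwa [_root_.interior_closedBall (0 : 𝔼 (n + 1)) one_ne_zero] at h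

/-- Values of an inverse germ: `g (d x) = x` on `𝔻`, `d (g y) = y` on `𝔻`, `g '' 𝔻 = 𝔻`. [folklore] -/
theorem inverse_on_closedBall (himg : d '' (𝔻 (n + 1)) = 𝔻 (n + 1)) {g : 𝔼 (n + 1) → 𝔼 (n + 1)}
    (hleft : ∀ᶠ x in 𝓝ˢ (𝔻 (n + 1)), g (d x) = x) :
    (∀ x ∈ 𝔻 (n + 1), g (d x) = x) ∧ (∀ y ∈ 𝔻 (n + 1), d (g y) = y) ∧
      g '' (𝔻 (n + 1)) = 𝔻 (n + 1) := by
  have hl : ∀ x ∈ 𝔻 (n + 1), g (d x) = x := fun x hx =>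
    (hleft.filter_mono (nhds_le_nhdsSet hx)).self_of_nhds
  have hr : ∀ y ∈ 𝔻 (n + 1), d (g y) = y := fun y hy => by
    obtain ⟨x, hx, rfl⟩ : y ∈ d '' (𝔻 (n + 1)) := by rw [himg]; exact hy
    rw [hl x hx]
  refine ⟨hl, hr, Subset.antisymm ?_ fun x hx => ?_⟩
  · rintro _ ⟨y, hy, rfl⟩
    obtain ⟨x, hx, rfl⟩ : y ∈ d '' (𝔻 (n + 1)) := by rw [himg]; exact hy
    rw [hl x hx]; exact hx
  · refine ⟨d x, ?_, hl x hx⟩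
    rw [← himg]; exact mem_image_of_mem d hx

/-- **An embedding germ of the closed unit ball onto itself maps the open ball onto the open
ball** (apply the previous lemma to `d` and to an inverse germ). [folklore] -/
theorem image_ball_eq (hd : IsEmbGerm (𝔻 (n + 1)) d) (himg : d '' (𝔻 (n + 1)) = 𝔻 (n + 1)) :
    d '' ball (0 : 𝔼 (n + 1)) 1 = ball 0 1 := by
  refine Subset.antisymm (hd.image_ball_subset himg) fun y hy => ?_
  obtain ⟨g, -, hleft, -, hg⟩ := hd.exists_inverse (isCompact_closedBall 0 1)
  rw [himg] at hg
  obtain ⟨hl, hr, hgimg⟩ := inverse_on_closedBall himg hleft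
  have hgy : g y ∈ ball (0 : 𝔼 (n + 1)) 1 := hg.image_ball_subset hgimg (mem_image_of_mem g hy)
  exact ⟨g y, hgy, hr y (ball_subset_closedBall hy)⟩

/-- **An embedding germ of the closed unit ball onto itself maps the unit sphere onto itself**
(invariance of the boundary). [folklore] -/
theorem image_sphere_eq (hd : IsEmbGerm (𝔻 (n + 1)) d) (himg : d '' (𝔻 (n + 1)) = 𝔻 (n + 1)) :
    d '' sphere (0 : 𝔼 (n + 1)) 1 = sphere 0 1 := by
  have hball := hd.image_ball_eq himg
  apply Subset.antisymm
  · rintro _ ⟨x, hx, rfl⟩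
    have hx' : x ∈ 𝔻 (n + 1) := sphere_subset_closedBall hx
    have h1 : d x ∈ 𝔻 (n + 1) := by rw [← himg]; exact mem_image_of_mem d hx'
    have h2 : d x ∉ ball (0 : 𝔼 (n + 1)) 1 := by
      rw [← hball]
      rintro ⟨x', hx'b, heq⟩
      have := hd.injOn (ball_subset_closedBall hx'b) hx' heq
      subst this
      exact (ne_of_lt (mem_ball_zero_iff.1 hx'b)) (mem_sphere_zero_iff_norm.1 hx)
    rw [mem_sphere_zero_iff_norm]
    exact le_antisymm (mem_closedBall_zero_iff.1 h1) (not_lt.1 fun h => h2 (mem_ball_zero_iff.2 h))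
  · intro y hy
    have hy' : y ∈ 𝔻 (n + 1) := sphere_subset_closedBall hy
    obtain ⟨x, hx, rfl⟩ : y ∈ d '' (𝔻 (n + 1)) := by rw [himg]; exact hy'
    refine ⟨x, ?_, rfl⟩
    have hxb : x ∉ ball (0 : 𝔼 (n + 1)) 1 := fun hxb =>
      (ne_of_lt (mem_ball_zero_iff.1 (hball ▸ mem_image_of_mem d hxb : d x ∈ ball 0 1)))
        (mem_sphere_zero_iff_norm.1 hy)
    rw [mem_sphere_zero_iff_norm]
    exact le_antisymm (mem_closedBall_zero_iff.1 hx) (not_lt.1 fun h => hxb (mem_ball_zero_iff.2 h))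

/-- **The boundary diffeomorphism**: the restriction to the unit sphere of an embedding germ of
the closed unit ball onto itself, as a diffeomorphism of `𝕊ⁿ`, together with its inverse read
off from an inverse germ. [cite: HirschDT1976, Ch. 8 §3 (boundary restriction `Diff Dⁿ → Diff Sⁿ⁻¹`)] -/
theorem exists_sphereDiffeomorph (hd : IsEmbGerm (𝔻 (n + 1)) d)
    (himg : d '' (𝔻 (n + 1)) = 𝔻 (n + 1)) :
    ∃ ψ : (𝕊 n) ≃ₘ⟮𝓡 n, 𝓡 n⟯ (𝕊 n), ∀ z : 𝕊 n, ((ψ z : 𝕊 n) : 𝔼 (n + 1)) = d z := by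
  obtain ⟨g, hgs, hleft, -, -⟩ := hd.exists_inverse (isCompact_closedBall 0 1)
  obtain ⟨hl, hr, hgimg⟩ := inverse_on_closedBall himg hleft
  have hsph := hd.image_sphere_eq himg
  -- `g` maps the sphere into the sphere too
  have hg1 : ∀ z : 𝕊 n, g z ∈ sphere (0 : 𝔼 (n + 1)) 1 := fun z => by
    obtain ⟨x, hx, hxz⟩ : (z : 𝔼 (n + 1)) ∈ d '' sphere (0 : 𝔼 (n + 1)) 1 := by rw [hsph]; exact z.2
    rw [← hxz, hl x (sphere_subset_closedBall hx)]; exact hx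
  have hf1 : ∀ z : 𝕊 n, d z ∈ sphere (0 : 𝔼 (n + 1)) 1 := fun z => by
    have h : d z ∈ d '' sphere (0 : 𝔼 (n + 1)) 1 := mem_image_of_mem d z.2
    rwa [hsph] at h
  have hfs : ContMDiff (𝓡 n) 𝓘(ℝ, 𝔼 (n + 1)) ∞ fun z : 𝕊 n => d z :=
    hd.contDiff.contMDiff.comp contMDiff_coe_sphere
  have hgs' : ContMDiff (𝓡 n) 𝓘(ℝ, 𝔼 (n + 1)) ∞ fun z : 𝕊 n => g z :=
    hgs.contMDiff.comp contMDiff_coe_sphere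
  refine ⟨{ toFun := fun z => ⟨d z, hf1 z⟩
            invFun := fun z => ⟨g z, hg1 z⟩
            left_inv := fun z => Subtype.ext (hl z (sphere_subset_closedBall z.2))
            right_inv := fun z => Subtype.ext (hr z (sphere_subset_closedBall z.2))
            contMDiff_toFun := hfs.codRestrict_sphere hf1
            contMDiff_invFun := hgs'.codRestrict_sphere hg1 }, fun z => rfl⟩


/-! ### Degree one: the boundary diffeomorphism of an orientation-preserving germ of `𝔻²` -/

section PlaneDegree

variable {d : 𝔼 2 → 𝔼 2}

/-- The determinant of a linear endomorphism of the plane in coordinates. [folklore] -/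
theorem det_plane (L : 𝔼 2 →ₗ[ℝ] 𝔼 2) :
    LinearMap.det L = L untwistE0 0 * L untwistE1 1 - L untwistE0 1 * L untwistE1 0 := by
  rw [← LinearMap.det_toMatrix (EuclideanSpace.basisFun (Fin 2) ℝ).toBasis L, Matrix.det_fin_two]
  simp only [LinearMap.toMatrix_apply, OrthonormalBasis.coe_toBasis, EuclideanSpace.basisFun_apply,
    OrthonormalBasis.coe_toBasis_repr_apply, EuclideanSpace.basisFun_repr]
  simp only [untwistE0, untwistE1]
  ring

/-- `circlePoint 0 = e₀` as a plane vector. [folklore] -/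
theorem coe_circlePoint_zero : ((circlePoint 0 : 𝕊 1) : 𝔼 2) = untwistE0 := by
  rw [coe_circlePoint_eq_smul_add, Real.cos_zero, Real.sin_zero, one_smul, zero_smul, add_zero]

/-- `circleTangent 0 = e₁`. [folklore] -/
theorem circleTangent_zero : circleTangent 0 = untwistE1 := by
  rw [circleTangent, Real.sin_zero, Real.cos_zero, neg_zero, zero_smul, one_smul, zero_add]

/-- **Outward normals map outward.**  For an embedding germ of the closed unit disc onto itself
and a boundary point `z`, the radial derivative `Dd(z) z` has non-negative inner product with
`d z`: the points `r z`, `r > 1`, are mapped outside the closed disc. [folklore] -/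
theorem inner_fderiv_radial_nonneg (hd : IsEmbGerm (𝔻 2) d) (himg : d '' (𝔻 2) = 𝔻 2)
    {z : 𝔼 2} (hz : ‖z‖ = 1) : 0 ≤ ⟪d z, fderiv ℝ d z z⟫ := by
  haveI : CompleteSpace (𝔼 2) := FiniteDimensional.complete ℝ _
  obtain ⟨U, hUo, hKU, hinj, -⟩ := hd.exists_nhds (isCompact_closedBall 0 1)
  have hzD : z ∈ 𝔻 2 := mem_closedBall_zero_iff.2 hz.le
  -- `ρ r = ‖d (r z)‖²` has a local minimum at `r = 1` from the right
  obtain ⟨ρ, hρ⟩ : ∃ ρ : ℝ → ℝ, ρ = fun r => ‖d (r • z)‖ ^ 2 := ⟨_, rfl⟩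
  have hρ1 : ρ 1 = 1 := by
    rw [hρ]; simp only [one_smul]
    have h1 : d z ∈ sphere (0 : 𝔼 2) 1 := by
      rw [← hd.image_sphere_eq himg]; exact mem_image_of_mem d (mem_sphere_zero_iff_norm.2 hz)
    rw [mem_sphere_zero_iff_norm.1 h1, one_pow]
  have hmin : IsLocalMinOn ρ (Ici 1) 1 := by
    -- for `r ≥ 1` near `1`, `r z ∈ U`; if `r > 1` then `d (r z) ∉ 𝔻`, so `ρ r > 1`
    have hc : Continuous fun r : ℝ => r • z := continuous_id.smul continuous_const
    have hU1 : ∀ᶠ r in 𝓝 (1 : ℝ), r • z ∈ U := hc.continuousAt.preimage_mem_nhds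
      (by rw [one_smul]; exact hUo.mem_nhds (hKU hzD))
    have hev : ∀ᶠ r in 𝓝[Ici 1] (1 : ℝ), ρ 1 ≤ ρ r := by
      have h1 : ∀ᶠ r in 𝓝[Ici 1] (1 : ℝ), r • z ∈ U := nhdsWithin_le_nhds hU1
      have h2 : ∀ᶠ r in 𝓝[Ici 1] (1 : ℝ), r ∈ Ici (1 : ℝ) := self_mem_nhdsWithin
      filter_upwards [h1, h2] with r hrU hr1
      rw [hρ1, hρ]
      rcases (mem_Ici.1 hr1).lt_or_eq with hlt | heq
      · -- `r > 1`: the image is outside the closed disc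
        have hnot : d (r • z) ∉ 𝔻 2 := by
          intro hin
          obtain ⟨x', hx', hxeq⟩ : d (r • z) ∈ d '' (𝔻 2) := by rw [himg]; exact hin
          have heq' : x' = r • z := hinj (hKU hx') hrU hxeq
          have hnorm : ‖r • z‖ ≤ 1 := by rw [← heq']; exact mem_closedBall_zero_iff.1 hx'
          rw [norm_smul, hz, mul_one, Real.norm_of_nonneg (zero_le_one.trans hlt.le)] at hnorm
          linarith
        have hgt : 1 < ‖d (r • z)‖ := not_le.1 fun h => hnot (mem_closedBall_zero_iff.2 h)
        show (1 : ℝ) ≤ ‖d (r • z)‖ ^ 2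
        nlinarith
      · rw [← heq]
        show (1 : ℝ) ≤ ‖d ((1 : ℝ) • z)‖ ^ 2
        rw [one_smul]
        have h1 : d z ∈ sphere (0 : 𝔼 2) 1 := by
          rw [← hd.image_sphere_eq himg]; exact mem_image_of_mem d (mem_sphere_zero_iff_norm.2 hz)
        rw [mem_sphere_zero_iff_norm.1 h1, one_pow]
    exact hev
  -- the derivative of `ρ` at `1`
  have hdiff : HasDerivAt (fun r : ℝ => d (r • z)) (fderiv ℝ d z z) 1 := by
    have h1 : HasDerivAt (fun r : ℝ => r • z) z 1 := by
      simpa using (hasDerivAt_id (1 : ℝ)).smul_const z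
    have h2 : HasFDerivAt d (fderiv ℝ d z) ((fun r : ℝ => r • z) 1) := by
      rw [show (fun r : ℝ => r • z) 1 = z from one_smul ℝ z]
      exact (hd.contDiff.differentiable (by simp) z).hasFDerivAt
    exact h2.comp_hasDerivAt 1 h1
  have hρd : HasDerivAt ρ (2 * ⟪d ((1 : ℝ) • z), fderiv ℝ d z z⟫) 1 := by
    rw [hρ]; exact hdiff.norm_sq
  rw [one_smul] at hρd
  have hy : (1 : ℝ) ∈ posTangentConeAt (Ici (1 : ℝ)) 1 := by
    refine mem_posTangentConeAt_of_segment_subset fun r hr => ?_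
    rw [segment_eq_Icc (by norm_num : (1 : ℝ) ≤ 1 + 1)] at hr
    exact mem_Ici.2 hr.1
  have hnn := hmin.hasFDerivWithinAt_nonneg hρd.hasFDerivAt.hasFDerivWithinAt hy
  -- `hnn : 0 ≤ (2 * ⟪d z, Dd z z⟫) • 1`-shaped
  have h2 : (0 : ℝ) ≤ 2 * ⟪d z, fderiv ℝ d z z⟫ := by simpa using hnn
  linarith

/-- **The boundary diffeomorphism of an orientation-preserving germ of the closed disc has a
lift with positive derivative** (hence degree one).  At `θ = 0`: `Dd(e₀)` maps the tangent
`e₁` to `Φ′(0)` times the tangent at the image and the outward normal `e₀` to a vector with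
non-negative outward component `a`; its determinant is `a Φ′(0) > 0`, so `Φ′(0) > 0`.
[cite: HirschDT1976, Ch. 8 §3 (degree of the boundary map)] -/
theorem deriv_lift_pos (hd : IsEmbGerm (𝔻 2) d) (himg : d '' (𝔻 2) = 𝔻 2)
    (hdet : ∀ x ∈ 𝔻 2, 0 < LinearMap.det (fderiv ℝ d x : 𝔼 2 →ₗ[ℝ] 𝔼 2))
    (ψ : (𝕊 1) ≃ₘ⟮𝓡 1, 𝓡 1⟯ (𝕊 1)) (hψ : ∀ z : 𝕊 1, ((ψ z : 𝕊 1) : 𝔼 2) = d z)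
    {Φ : ℝ → ℝ} (hΦc : Continuous Φ) (hlift : ∀ θ, circlePoint (Φ θ) = ψ (circlePoint θ)) :
    0 < deriv Φ 0 := by
  haveI : CompleteSpace (𝔼 2) := FiniteDimensional.complete ℝ _
  have hne : deriv Φ 0 ≠ 0 := deriv_ne_zero_of_lift ψ hΦc hlift 0
  have hΦs : ContDiff ℝ ∞ Φ :=
    contDiff_of_circlePoint_comp_eq (ψ.contMDiff.comp contMDiff_circlePoint) hΦc hlift
  have hΦd : HasDerivAt Φ (deriv Φ 0) 0 := (hΦs.differentiable (by simp) 0).hasDerivAt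
  -- the identity `d (circlePoint θ) = circlePoint (Φ θ)` as plane curves
  have hcurve : (fun θ : ℝ => d ((circlePoint θ : 𝕊 1) : 𝔼 2)) =
      fun θ => ((circlePoint (Φ θ) : 𝕊 1) : 𝔼 2) := by
    funext θ; rw [hlift θ, hψ]
  -- tangents: `Dd(e₀) e₁ = Φ′(0) · circleTangent (Φ 0)`
  have hL : HasDerivAt (fun θ : ℝ => d ((circlePoint θ : 𝕊 1) : 𝔼 2))
      (fderiv ℝ d untwistE0 untwistE1) 0 := by
    have h1 := hasDerivAt_coe_circlePoint 0
    rw [circleTangent_zero] at h1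
    have h2 : HasFDerivAt d (fderiv ℝ d untwistE0) ((fun t : ℝ => ((circlePoint t : 𝕊 1) : 𝔼 2)) 0) := by
      rw [show (fun t : ℝ => ((circlePoint t : 𝕊 1) : 𝔼 2)) 0 = untwistE0 from coe_circlePoint_zero]
      exact (hd.contDiff.differentiable (by simp) _).hasFDerivAt
    exact h2.comp_hasDerivAt 0 h1
  have hR : HasDerivAt (fun θ : ℝ => ((circlePoint (Φ θ) : 𝕊 1) : 𝔼 2))
      (deriv Φ 0 • circleTangent (Φ 0)) 0 :=
    (hasDerivAt_coe_circlePoint (Φ 0)).scomp 0 hΦd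
  rw [hcurve] at hL
  have htan : fderiv ℝ d untwistE0 untwistE1 = deriv Φ 0 • circleTangent (Φ 0) := hL.unique hR
  -- normals: `a = ⟪d e₀, Dd(e₀) e₀⟫ ≥ 0`, with `d e₀ = circlePoint (Φ 0)`
  have hde₀ : d untwistE0 = ((circlePoint (Φ 0) : 𝕊 1) : 𝔼 2) := by
    have h := congrFun hcurve 0
    simp only [coe_circlePoint_zero] at h
    exact h
  have ha : 0 ≤ ⟪d untwistE0, fderiv ℝ d untwistE0 untwistE0⟫ :=
    inner_fderiv_radial_nonneg hd himg (by simp [untwistE0])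
  -- the determinant at `e₀` is `a Φ′(0)`
  have hdet₀ := hdet untwistE0 (mem_closedBall_zero_iff.2 (by simp [untwistE0]))
  rw [det_plane] at hdet₀
  have hv := inner_plane (d untwistE0) (fderiv ℝ d untwistE0 untwistE0)
  rw [hde₀] at hv ha
  set v : 𝔼 2 := fderiv ℝ d untwistE0 untwistE0 with hvdef
  have hw0 : ((circlePoint (Φ 0) : 𝕊 1) : 𝔼 2) 0 = Real.cos (Φ 0) := circlePoint_apply_zero _
  have hw1 : ((circlePoint (Φ 0) : 𝕊 1) : 𝔼 2) 1 = Real.sin (Φ 0) := circlePoint_apply_one _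
  have ht0 : (fderiv ℝ d untwistE0 untwistE1) 0 = -(deriv Φ 0 * Real.sin (Φ 0)) := by
    rw [htan]; simp
  have ht1 : (fderiv ℝ d untwistE0 untwistE1) 1 = deriv Φ 0 * Real.cos (Φ 0) := by
    rw [htan]; simp
  change 0 < (v 0) * (fderiv ℝ d untwistE0 untwistE1) 1 - (v 1) * (fderiv ℝ d untwistE0 untwistE1) 0
    at hdet₀
  rw [ht0, ht1] at hdet₀
  rw [hw0, hw1] at hv
  -- `det = Φ′(0) · a` with `a = cos α v₀ + sin α v₁ ≥ 0`
  have hdet' : (v 0 * (deriv Φ 0 * Real.cos (Φ 0)) - v 1 * -(deriv Φ 0 * Real.sin (Φ 0))) =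
      deriv Φ 0 * (Real.cos (Φ 0) * v 0 + Real.sin (Φ 0) * v 1) := by ring
  rw [hdet'] at hdet₀
  rw [hv] at ha
  rcases lt_or_gt_of_ne hne with hneg | hpos
  · exfalso
    have : deriv Φ 0 * (Real.cos (Φ 0) * v 0 + Real.sin (Φ 0) * v 1) ≤ 0 :=
      mul_nonpos_of_nonpos_of_nonneg hneg.le ha
    linarith
  · exact hpos

/-- **The boundary diffeomorphism of an orientation-preserving embedding germ of the closed
disc onto itself has degree one**, hence is the end of a diffeotopy of the circle
(Hirsch's Thm. 8.3.3, `exists_ambientIsotopy_of_hasDegreeOne`).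
[cite: HirschDT1976, Ch. 8 §3, Thm. 3.3] -/
theorem exists_circle_ambientIsotopy (hd : IsEmbGerm (𝔻 2) d) (himg : d '' (𝔻 2) = 𝔻 2)
    (hdet : ∀ x ∈ 𝔻 2, 0 < LinearMap.det (fderiv ℝ d x : 𝔼 2 →ₗ[ℝ] 𝔼 2)) :
    ∃ (ψ : (𝕊 1) ≃ₘ⟮𝓡 1, 𝓡 1⟯ (𝕊 1)) (F : AmbientIsotopy (𝓡 1) (𝕊 1)),
      (∀ z : 𝕊 1, ((ψ z : 𝕊 1) : 𝔼 2) = d z) ∧ F.toFun 1 = ψ := by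
  obtain ⟨ψ, hψ⟩ := hd.exists_sphereDiffeomorph (n := 1) himg
  have hcont : Continuous fun θ : ℝ => ψ (circlePoint θ) :=
    ψ.continuous.comp contMDiff_circlePoint.continuous
  obtain ⟨Φ, hΦc, hlift⟩ := exists_continuous_circlePoint_comp_eq hcont
  have hdeg : HasDegreeOne ψ :=
    hasDegreeOne_of_lift_of_deriv_pos ψ hΦc hlift (deriv_lift_pos hd himg hdet ψ hψ hΦc hlift)
  obtain ⟨F, hF⟩ := exists_ambientIsotopy_of_hasDegreeOne ψ hdeg
  exact ⟨ψ, F, hψ, hF⟩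

end PlaneDegree

end IsEmbGerm

end Literature.Topology.FourManifolds
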